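import Literature.NumberTheory.DiophantineGeometry.SchurWeylPlethysm
import Mathlib.LinearAlgebra.PiTensorProduct.Basis
import Mathlib.Data.Fintype.Pigeonhole
import HarnessLib

/-!
# Weyl modules — discharged facts

Proofs of named facts stated in `Literature.NumberTheory.DiophantineGeometry.SchurWeylPlethysm`
(kept in a sibling file so that the statement file stays a definitions/named-facts file and
does not import `PiTensorProduct.Basis`).

* `Literature.NumberTheory.DiophantineGeometry.weylModule_eq_bot_iff_holds` discharges `Literature.NumberTheory.DiophantineGeometry.weylModule_eq_bot_iff`:
  in characteristic zero the Weyl module `S_μ(k^σ) = c_μ · (k^σ)^{⊗d}` (image of the Young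
  symmetrizer `c_μ = a_μ b_μ` of the canonical tableau) is zero iff `μ` has more than `|σ|`
  parts.

## Proof

The standard basis `e_g = ⊗_i e_{g i}` (`g : Fin d → σ`, `tensorBasis`) of `(k^σ)^{⊗d}` is
permuted by `S_d`: `τ · e_g = e_{g ∘ τ⁻¹}` (`permTensorRep_tensorBasis`).

* If `μ` has more than `|σ|` rows, every `g` repeats a value at two positions `i ≠ j` of the
  first column (pigeonhole, `exists_ne_colOf_eq_apply_eq`); the transposition `τ = (i j)` lies
  in `C_μ` and fixes `e_g`, while `b_μ τ = -b_μ` (`colAntisymmetrizer_mul_of`), so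
  `b_μ e_g = -b_μ e_g = 0` and `c_μ = a_μ b_μ` acts by zero (`weylModule_eq_bot_of_card_lt`).
* If `μ` has at most `|σ|` rows, choose an injection `ι` of the rows into `σ` and let `f` fill
  every box of row `r` with `ι r` (the tableau `U(μ)`). For the coordinate form `φ = e_f^*`:
  `φ ∘ p = φ` for `p ∈ R_μ` (as `f ∘ p = f`), so `φ ∘ a_μ = |R_μ| φ`; and
  `φ (b_μ e_f) = ∑_{q ∈ C_μ} sgn(q) [f ∘ q = f] = 1` because `f ∘ q = f` forces
  `q ∈ R_μ ∩ C_μ = 1` (`eq_one_of_mem_rowStabilizer_of_mem_colStabilizer`). Hence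
  `φ (c_μ e_f) = |R_μ| ≠ 0` and `S_μ(k^σ) ≠ 0` (`weylModule_ne_bot_of_card_le`).

This is the argument of Fulton–Harris, Thm 6.3 (1) (`S_λ V = V^{⊗d} c_λ ⊆ V^{⊗d} a_λ b_λ`, and
`b_λ` kills `∧^{μ'_1} V ⊗ ⋯` when a column is longer than `dim V`) and of Fulton, *Young
Tableaux*, §8.1: Lemma 1 (i) (`e_T = 0` if `T` repeats an entry in a column) and Thm 1 (`E^λ`
is free on the `e_T`, `T` a tableau with entries in `[m]`; there is no such tableau iff `λ` has
more than `m` rows), with §8.3, p. 115 (`E^λ` is the image of the Young symmetrizer on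
`E^{⊗n}`).

## References

* W. Fulton, *Young Tableaux*, LMS Student Texts 35 (1997), §8.1 Lemma 1, Thm 1 (p. 105);
  §8.3 (p. 115).
* W. Fulton, J. Harris, *Representation Theory. A First Course*, GTM 129 (1991), Thm 6.3 (1)
  (p. 77) and its proof, §6.2 (p. 87).

## Mathlib

`Basis.piTensorProduct` (`Basis.piTensorProduct_apply`, `Basis.piTensorProduct_repr_tprod_apply`),
`Pi.basisFun`, `Fintype.exists_ne_map_eq_of_card_lt`, `Function.Embedding.nonempty_of_card_le`,
`Equiv.Perm.sign_swap`, `Equiv.apply_swap_eq_self`.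
-/

noncomputable section

open scoped BigOperators TensorProduct

namespace Literature.NumberTheory.DiophantineGeometry

section WeylVanishingProof

variable {k : Type*} [Field k] {d : ℕ}

/-! #### Group-algebra and tableau lemmas -/

open scoped Classical in
/-- The column antisymmetrizer absorbs column permutations with a sign:
`b_μ · τ = sgn(τ) b_μ` for `τ ∈ C_μ` (Fulton–Harris §4.1, proof of Lemma 4.25; Fulton,
*Young Tableaux*, §7.2). [folklore] -/
theorem colAntisymmetrizer_mul_of {μ : Nat.Partition d} {τ : Equiv.Perm (Fin d)}
    (hτ : τ ∈ colStabilizer μ) :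
    colAntisymmetrizer k μ * MonoidAlgebra.of k _ τ =
      ((Equiv.Perm.sign τ : ℤ) : k) • colAntisymmetrizer k μ := by
  have ht : ((Equiv.Perm.sign τ : ℤ) : k) * ((Equiv.Perm.sign τ : ℤ) : k) = 1 := by
    rw [← Int.cast_mul, ← Units.val_mul, Int.units_mul_self, Units.val_one, Int.cast_one]
  unfold colAntisymmetrizer
  rw [Finset.sum_mul, Finset.smul_sum]
  refine Finset.sum_equiv (Equiv.mulRight τ) (fun q => ?_) (fun q _ => ?_)
  · simp only [Equiv.coe_mulRight, Set.mem_toFinset, SetLike.mem_coe]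
    exact ⟨fun h => mul_mem h hτ, fun h => by simpa using mul_mem h (inv_mem hτ)⟩
  · rw [Equiv.coe_mulRight, smul_mul_assoc, smul_smul, map_mul, map_mul, Units.val_mul,
      Int.cast_mul, mul_left_comm, ht, mul_one]

/-- Operator form of `colAntisymmetrizer_mul_of`: in any representation, `B ∘ τ = sgn(τ) B` for
the operator `B` of the column antisymmetrizer and `τ ∈ C_μ`. [folklore] -/
theorem asAlgebraHom_colAntisymmetrizer_comp {V : Type*} [AddCommGroup V] [Module k V]
    (ρ : Representation k (Equiv.Perm (Fin d)) V) {μ : Nat.Partition d}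
    {τ : Equiv.Perm (Fin d)} (hτ : τ ∈ colStabilizer μ) :
    ρ.asAlgebraHom (colAntisymmetrizer k μ) ∘ₗ ρ τ =
      ((Equiv.Perm.sign τ : ℤ) : k) • ρ.asAlgebraHom (colAntisymmetrizer k μ) := by
  rw [← Representation.asAlgebraHom_of, ← Module.End.mul_eq_comp, ← map_mul,
    colAntisymmetrizer_mul_of hτ, map_smul]

open scoped Classical in
/-- The row symmetrizer acts in a representation `ρ` as `∑_{p ∈ R_μ} ρ(p)`. Unfolding lemma.
[folklore] -/
theorem asAlgebraHom_rowSymmetrizer_apply {V : Type*} [AddCommGroup V] [Module k V]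
    (ρ : Representation k (Equiv.Perm (Fin d)) V) (μ : Nat.Partition d) (x : V) :
    ρ.asAlgebraHom (rowSymmetrizer k μ) x =
      ∑ p ∈ (rowStabilizer μ : Set (Equiv.Perm (Fin d))).toFinset, ρ p x := by
  simp only [rowSymmetrizer, map_sum, Representation.asAlgebraHom_of, LinearMap.coe_sum,
    Finset.sum_apply]

open scoped Classical in
/-- The column antisymmetrizer acts in a representation `ρ` as `∑_{q ∈ C_μ} sgn(q) ρ(q)`.
Unfolding lemma. [folklore] -/
theorem asAlgebraHom_colAntisymmetrizer_apply {V : Type*} [AddCommGroup V] [Module k V]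
    (ρ : Representation k (Equiv.Perm (Fin d)) V) (μ : Nat.Partition d) (x : V) :
    ρ.asAlgebraHom (colAntisymmetrizer k μ) x =
      ∑ q ∈ (colStabilizer μ : Set (Equiv.Perm (Fin d))).toFinset,
        ((Equiv.Perm.sign q : ℤ) : k) • ρ q x := by
  simp only [colAntisymmetrizer, map_sum, map_smul, Representation.asAlgebraHom_of,
    LinearMap.coe_sum, Finset.sum_apply, LinearMap.smul_apply]

/-- A transposition of two positions in the same column of the canonical tableau lies in the
column stabilizer. [folklore] -/
theorem swap_mem_colStabilizer (μ : Nat.Partition d) {i j : Fin d} (h : μ.colOf i = μ.colOf j) :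
    Equiv.swap i j ∈ colStabilizer μ := by
  intro x
  rcases eq_or_ne x i with rfl | hxi
  · rw [Equiv.swap_apply_left]; exact h.symm
  rcases eq_or_ne x j with rfl | hxj
  · rw [Equiv.swap_apply_right]; exact h
  rw [Equiv.swap_apply_of_ne_of_ne hxi hxj]

/-- `R_μ ∩ C_μ = 1`: a permutation preserving both the row and the column of every position is
the identity, a box being determined by its row and column
(`Nat.Partition.mem_youngDiagram_iff_existsUnique_rowOf_colOf`). Fulton–Harris §4.1 (proof
of Lemma 4.26). [folklore] -/
theorem eq_one_of_mem_rowStabilizer_of_mem_colStabilizer (μ : Nat.Partition d)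
    {q : Equiv.Perm (Fin d)} (hr : q ∈ rowStabilizer μ) (hc : q ∈ colStabilizer μ) : q = 1 := by
  ext i : 1
  obtain ⟨i₀, -, huniq⟩ :=
    (μ.mem_youngDiagram_iff_existsUnique_rowOf_colOf _).mp (μ.rowOf_colOf_mem_youngDiagram i)
  rw [Equiv.Perm.coe_one, id]
  exact (huniq (q i) (show (μ.rowOf (q i), μ.colOf (q i)) = _ by rw [hr i, hc i])).trans
    (huniq i rfl).symm

/-- The first column of the canonical tableau of `μ` meets every row in one box: an injection
of the rows into the positions of column `0`. [folklore] -/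
theorem exists_injective_colOf_eq_zero (μ : Nat.Partition d) :
    ∃ box : Fin μ.sortedParts.length → Fin d,
      Function.Injective box ∧ ∀ r, μ.colOf (box r) = 0 := by
  have hmem : ∀ r : Fin μ.sortedParts.length, ((r : ℕ), 0) ∈ μ.youngDiagram := fun r => by
    rw [Nat.Partition.mem_youngDiagram_iff]
    exact ⟨r.isLt, μ.pos_of_mem_sortedParts (List.getElem_mem _)⟩
  choose box hbox using fun r =>
    ((μ.mem_youngDiagram_iff_existsUnique_rowOf_colOf _).mp (hmem r)).exists
  refine ⟨box, fun r s hrs => ?_, fun r => congrArg Prod.snd (hbox r)⟩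
  have hr := congrArg Prod.fst (hbox r)
  have hs := congrArg Prod.fst (hbox s)
  simp only at hr hs
  exact Fin.ext (by rw [← hr, ← hs, hrs])

/-! #### The standard basis of `(k^σ)^{⊗d}` -/

section Basis

variable {σ : Type*} [Fintype σ]

variable (k σ) in
/-- The standard basis `e_g = ⊗_i e_{g i}` of `(k^σ)^{⊗d}` indexed by fillings `g : Fin d → σ`
of the `d` tensor positions by basis indices (Mathlib `Basis.piTensorProduct` of the standard
bases `Pi.basisFun k σ`). Fulton, *Young Tableaux*, §8.1 (the `e_T` in `E^{⊗n}`, proof of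
Lemma 1). [folklore] -/
def tensorBasis (d : ℕ) : Module.Basis (Fin d → σ) k (TensorPower k d (σ → k)) :=
  Basis.piTensorProduct fun _ => Pi.basisFun k σ

/-- `tensorBasis k σ d g` is the pure tensor of the standard basis vectors `e_{g i}`.
[folklore] -/
theorem tensorBasis_apply (g : Fin d → σ) :
    tensorBasis k σ d g = PiTensorProduct.tprod k fun i => Pi.basisFun k σ (g i) :=
  Basis.piTensorProduct_apply _ g

/-- Coordinates of a pure tensor in the standard basis: the `g`-th coordinate of `⊗_i x_i` is
`∏_i (x_i)_{g i}`. [folklore] -/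
theorem tensorBasis_repr_tprod (x : Fin d → σ → k) (g : Fin d → σ) :
    (tensorBasis k σ d).repr (PiTensorProduct.tprod k x) g = ∏ i, x i (g i) := by
  rw [tensorBasis, Basis.piTensorProduct_repr_tprod_apply]
  simp only [Pi.basisFun_repr]

/-- Coordinates transform under the permutation action by relabelling: the `g`-th coordinate
of `τ · x` is the `(g ∘ τ)`-th coordinate of `x`. [folklore] -/
theorem tensorBasis_repr_permTensorRep (τ : Equiv.Perm (Fin d)) (x : TensorPower k d (σ → k))
    (g : Fin d → σ) :
    (tensorBasis k σ d).repr (permTensorRep k (σ → k) d τ x) g =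
      (tensorBasis k σ d).repr x (g ∘ τ) := by
  suffices h : (tensorBasis k σ d).coord g ∘ₗ permTensorRep k (σ → k) d τ =
      (tensorBasis k σ d).coord (g ∘ τ) from
    LinearMap.congr_fun h x
  ext x
  simp only [LinearMap.compMultilinearMap_apply, LinearMap.coe_comp, Function.comp_apply,
    Module.Basis.coord_apply, permTensorRep_tprod, tensorBasis_repr_tprod]
  exact Fintype.prod_equiv τ.symm _ _ fun i => by simp

/-- The permutation action permutes the standard basis: `τ · e_g = e_{g ∘ τ⁻¹}`. Fulton–Harris
§6.1. [folklore] -/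
theorem permTensorRep_tensorBasis (τ : Equiv.Perm (Fin d)) (g : Fin d → σ) :
    permTensorRep k (σ → k) d τ (tensorBasis k σ d g) = tensorBasis k σ d (g ∘ τ.symm) := by
  rw [tensorBasis_apply, permTensorRep_tprod, tensorBasis_apply]
  rfl

/-- **Repeated entries in a column are killed by the column antisymmetrizer**: if the filling
`g` takes the same value at two positions of one column, then `b_μ · e_g = 0` (in
characteristic `≠ 2`; here characteristic zero): the transposition `τ` of the two positions
fixes `e_g` and `b_μ τ = -b_μ`. Fulton, *Young Tableaux*, §8.1, relation (i) of Lemma 1;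
Fulton–Harris, proof of Thm 6.3 (1). [folklore] -/
theorem asAlgebraHom_colAntisymmetrizer_tensorBasis_eq_zero [CharZero k] (μ : Nat.Partition d)
    (g : Fin d → σ) {i j : Fin d} (hij : i ≠ j) (hc : μ.colOf i = μ.colOf j) (hg : g i = g j) :
    (permTensorRep k (σ → k) d).asAlgebraHom (colAntisymmetrizer k μ) (tensorBasis k σ d g) =
      0 := by
  have hfix : permTensorRep k (σ → k) d (Equiv.swap i j) (tensorBasis k σ d g) =
      tensorBasis k σ d g := by
    rw [permTensorRep_tensorBasis, Equiv.symm_swap]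
    congr 1
    funext x
    exact Equiv.apply_swap_eq_self hg x
  have key : (permTensorRep k (σ → k) d).asAlgebraHom (colAntisymmetrizer k μ)
        (tensorBasis k σ d g) =
      -(permTensorRep k (σ → k) d).asAlgebraHom (colAntisymmetrizer k μ)
        (tensorBasis k σ d g) := by
    conv_lhs => rw [← hfix]
    change ((permTensorRep k (σ → k) d).asAlgebraHom (colAntisymmetrizer k μ) ∘ₗ
      permTensorRep k (σ → k) d (Equiv.swap i j)) _ = _
    rw [asAlgebraHom_colAntisymmetrizer_comp _ (swap_mem_colStabilizer μ hc),
      Equiv.Perm.sign_swap hij, LinearMap.smul_apply, Units.val_neg, Units.val_one,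
      Int.cast_neg, Int.cast_one, neg_smul, one_smul]
  have h2 : (2 : k) • (permTensorRep k (σ → k) d).asAlgebraHom (colAntisymmetrizer k μ)
      (tensorBasis k σ d g) = 0 := by
    rw [two_smul]
    nth_rewrite 2 [key]
    exact add_neg_cancel _
  exact (smul_eq_zero.mp h2).resolve_left two_ne_zero

/-- Pigeonhole in the first column: if `μ` has more parts than `|σ|`, every filling
`g : Fin d → σ` repeats a value at two positions of one column. Fulton–Harris, proof of
Thm 6.3 (1). [folklore] -/
theorem exists_ne_colOf_eq_apply_eq (μ : Nat.Partition d) (h : Fintype.card σ < μ.parts.card)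
    (g : Fin d → σ) : ∃ i j : Fin d, i ≠ j ∧ μ.colOf i = μ.colOf j ∧ g i = g j := by
  obtain ⟨box, hinj, hcol⟩ := exists_injective_colOf_eq_zero μ
  have hlt : Fintype.card σ < Fintype.card (Fin μ.sortedParts.length) := by
    rwa [Fintype.card_fin, Nat.Partition.length_sortedParts]
  obtain ⟨r, s, hrs, hg⟩ := Fintype.exists_ne_map_eq_of_card_lt (g ∘ box) hlt
  exact ⟨box r, box s, hinj.ne hrs, by rw [hcol, hcol], hg⟩

end Basis

/-! #### The two directions -/

variable {σ : Type*} [Fintype σ]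

/-- **Vanishing direction.** If `μ` has more than `|σ|` parts then the column antisymmetrizer,
hence the Young symmetrizer `c_μ = a_μ b_μ`, acts by zero on `(k^σ)^{⊗d}`, so `S_μ(k^σ) = 0`.
Fulton–Harris Thm 6.3 (1); Fulton, *Young Tableaux*, §8.1 (no tableau on `μ` with entries in
`[m]` exists when `μ` has more than `m` rows). [folklore] -/
theorem weylModule_eq_bot_of_card_lt [CharZero k] (μ : Nat.Partition d)
    (h : Fintype.card σ < μ.parts.card) : weylModule k σ μ = ⊥ := by
  rw [weylModule, LinearMap.range_eq_bot, youngSymmetrizer, map_mul]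
  suffices hB : (permTensorRep k (σ → k) d).asAlgebraHom (colAntisymmetrizer k μ) = 0 by
    rw [hB, mul_zero]
  refine (tensorBasis k σ d).ext fun g => ?_
  obtain ⟨i, j, hij, hc, hg⟩ := exists_ne_colOf_eq_apply_eq μ h g
  rw [LinearMap.zero_apply]
  exact asAlgebraHom_colAntisymmetrizer_tensorBasis_eq_zero μ g hij hc hg

/-- **Non-vanishing direction.** If `μ` has at most `|σ|` parts, then `S_μ(k^σ) ≠ 0`
(characteristic zero): for the filling `f` placing `e_{ι(r)}` in every box of row `r`
(`ι : rows ↪ σ`), the `e_f`-coordinate of `c_μ · e_f = a_μ b_μ e_f` is `|R_μ| ≠ 0`, because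
`p q` fixes `f` (`p ∈ R_μ`, `q ∈ C_μ`) only if `q ∈ R_μ ∩ C_μ = 1`. Fulton–Harris Thm 6.3 (1);
Fulton, *Young Tableaux*, §8.1 Thm 1 (the `e_T`, `T` a tableau, are free generators; here
`T = U(μ)` of §8.2 Lemma 4). [folklore] -/
theorem weylModule_ne_bot_of_card_le [CharZero k] (μ : Nat.Partition d)
    (h : μ.parts.card ≤ Fintype.card σ) : weylModule k σ μ ≠ ⊥ := by
  classical
  -- an injection of the rows into the index set `σ`
  obtain ⟨ι⟩ : Nonempty (Fin μ.sortedParts.length ↪ σ) :=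
    Function.Embedding.nonempty_of_card_le (by rwa [Fintype.card_fin, μ.length_sortedParts])
  -- the canonical filling: box `i` carries the basis vector indexed by its row
  let f : Fin d → σ := fun i => ι ⟨μ.rowOf i, μ.rowOf_lt_length i⟩
  have hf_row : ∀ p ∈ rowStabilizer μ, f ∘ p = f := fun p hp => by
    funext i
    simp only [Function.comp_apply, f, hp i]
  have hf_col : ∀ q ∈ colStabilizer μ, f ∘ q = f → q = 1 := fun q hq hfq => by
    refine eq_one_of_mem_rowStabilizer_of_mem_colStabilizer μ (fun i => ?_) hq
    have := congr_fun hfq i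
    simp only [Function.comp_apply, f] at this
    exact congrArg Fin.val (ι.injective this)
  -- `φ ∘ p = φ` for `p ∈ R_μ`, hence `φ ∘ a_μ = |R_μ| φ`, for the coordinate `φ` at `e_f`
  have hφA : ∀ y, (tensorBasis k σ d).coord f
      ((permTensorRep k (σ → k) d).asAlgebraHom (rowSymmetrizer k μ) y) =
      ((rowStabilizer μ : Set (Equiv.Perm (Fin d))).toFinset.card : k) *
        (tensorBasis k σ d).coord f y := fun y => by
    rw [asAlgebraHom_rowSymmetrizer_apply, map_sum]
    rw [Finset.sum_congr rfl fun p hp => ?_, Finset.sum_const, nsmul_eq_mul]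
    rw [Module.Basis.coord_apply, tensorBasis_repr_permTensorRep,
      hf_row p (Set.mem_toFinset.mp hp), Module.Basis.coord_apply]
  -- `φ (b_μ e_f) = 1`
  have hφB : (tensorBasis k σ d).coord f
      ((permTensorRep k (σ → k) d).asAlgebraHom (colAntisymmetrizer k μ)
        (tensorBasis k σ d f)) = 1 := by
    rw [asAlgebraHom_colAntisymmetrizer_apply, map_sum,
      Finset.sum_eq_single_of_mem 1 (Set.mem_toFinset.mpr (one_mem _))]
    · simp [Module.Basis.coord_apply]
    · intro q hq hq1
      rw [map_smul, Module.Basis.coord_apply, tensorBasis_repr_permTensorRep,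
        Module.Basis.repr_self, Finsupp.single_apply, if_neg, smul_zero]
      exact fun hfq => hq1 (hf_col q (Set.mem_toFinset.mp hq) hfq.symm)
  -- the element `c_μ e_f ∈ S_μ(k^σ)` has `φ`-coordinate `|R_μ| ≠ 0`
  have hmem : (permTensorRep k (σ → k) d).asAlgebraHom (rowSymmetrizer k μ)
      ((permTensorRep k (σ → k) d).asAlgebraHom (colAntisymmetrizer k μ)
        (tensorBasis k σ d f)) ∈ weylModule k σ μ := by
    refine ⟨tensorBasis k σ d f, ?_⟩
    rw [youngSymmetrizer, map_mul]
    rfl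
  have hcard : ((rowStabilizer μ : Set (Equiv.Perm (Fin d))).toFinset.card : k) ≠ 0 := by
    rw [Nat.cast_ne_zero, ← Nat.pos_iff_ne_zero, Finset.card_pos]
    exact ⟨1, Set.mem_toFinset.mpr (one_mem (rowStabilizer μ))⟩
  intro hbot
  rw [hbot, Submodule.mem_bot] at hmem
  have := hφA ((permTensorRep k (σ → k) d).asAlgebraHom (colAntisymmetrizer k μ)
    (tensorBasis k σ d f))
  rw [hmem, map_zero, hφB, mul_one] at this
  exact hcard this.symm

variable (k σ) in
/-- **Discharge of `weylModule_eq_bot_iff`.** The Weyl module `S_μ(k^σ) = c_μ · (k^σ)^{⊗d}`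
vanishes iff `μ` has more than `|σ|` parts (characteristic zero). Both directions are the
standard-basis computation: if `μ` has more than `|σ|` rows, every basis tensor `e_g` repeats an
index in the first column and is killed by `b_μ` (`weylModule_eq_bot_of_card_lt`); otherwise
the `e_f`-coordinate of `c_μ e_f`, `f` the filling constant along rows and injective on rows,
is `|R_μ| ≠ 0` (`weylModule_ne_bot_of_card_le`). Fulton–Harris Thm 6.3 (1); Fulton, *Young
Tableaux*, §8.1 Thm 1 (p. 105: `E^λ` is free on the `e_T`, `T` a tableau on `λ` with entries
in `[m]` — there is none iff `λ` has more than `m` rows) with §8.3 (p. 115: `E^λ` is the image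
of the Young symmetrizer on `E^{⊗n}`).
[cite: FultonYoungTableaux1997, §8.1 Thm. 1] [cite: FultonHarrisGTM129, Thm. 6.3 (1)] -/
theorem weylModule_eq_bot_iff_holds : weylModule_eq_bot_iff k σ (d := d) := by
  intro _ μ
  refine ⟨fun h => ?_, weylModule_eq_bot_of_card_lt μ⟩
  by_contra hle
  exact weylModule_ne_bot_of_card_le μ (not_lt.mp hle) h

end WeylVanishingProof

end Literature.NumberTheory.DiophantineGeometry
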